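import Literature.Geometry.Manifold.SmoothSingularCochains
import Literature.Geometry.Manifold.SimplexIntegral
import Literature.Geometry.Kaehler.LocalDeRhamComplex
import HarnessLib

/-!
# The de Rham homomorphism `Ω•(U) → Hom(Δ•^{smooth}(U), ℝ)` as a map of cochain complexes

Fifth brick of the integration proof of **de Rham's theorem** (de Rham 1931; Bredon (1993),
§V.5 and Thm. V.9.5; Lee (2013), pp. 480–484, Thm. 18.14; Warner (1983), 4.17–4.19, 5.36).

For every open `U ⊆ M` of a `C^∞` manifold, integration of real `k`-forms on `U` over smooth
singular `k`-simplices with image in `U` (`…SingularSimplex.formIntegral`, `SimplexIntegral.lean`)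
defines a linear map `Ωᵏ(U) → Hom_ℝ(Δₖ^{sm}(U), ℝ)`; by **Stokes' formula**
(`…SingularSimplex.formIntegral_mextDeriv`) these maps form a morphism of cochain complexes

`deRhamMap I hU : localDeRhamComplex I ℝ hU ⟶ smoothSubsetCochains I ℝ (ULift ℝ) M U`

(the **de Rham homomorphism**, Bredon's `Ψ : Ω*(U) → Δ*_{smooth}(U; ℝ)`, Lee's `ℐ`). We prove:

* `deRhamMap_naturality_res`: naturality under restriction to a smaller open set (Bredon (1993),
  §V.9, the commutative squares of the functor `U ↦ Ψ_U`);
* `deRhamMap_mv`: the induced morphism from the Mayer–Vietoris short exact sequence of de Rham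
  complexes (`localDeRhamComplex.mvShortComplex`) to that of smooth cochains
  (`smoothSubsetCochains.mvShortComplex`), and `isIso_homologyMap_deRhamMap_union`: **if `Ψ_A`,
  `Ψ_B`, `Ψ_{A∩B}` are isomorphisms on cohomology then so is `Ψ_{A∪B}`** (Bredon (1993),
  Lemma V.9.4 applied as in the proof of Thm. V.9.5; the five lemma is the tree's
  `Literature.Algebra.Homology.isIso_homologyMap_τ₁_of_forall`);
* `deRhamMap_f_map`: naturality under `C^∞` maps at the level of all of `M`
  (`∫_{φ∘σ} η = ∫_σ φ^*η`).

Coefficients are real (`F = ℝ`, cochain values in `ULift ℝ`, matching the tree's comparison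
`subsetCochains.homologyIsoSingularCohomology` with `singularCohomology ℝ ℝ`).

## References

* G. E. Bredon, *Topology and Geometry* (1993), §V.5, §V.9 (Lemma V.9.4, Thm. V.9.5).
* J. M. Lee, *Introduction to Smooth Manifolds*, 2nd ed. (2013), Thm. 18.12, Thm. 18.14.
* F. W. Warner, *Foundations of Differentiable Manifolds and Lie Groups* (1983), 4.17–4.19, 5.36.
-/

noncomputable section

-- see "Implementation notes" in `…SingularHomology.SingularChainsConcrete`
set_option backward.isDefEq.respectTransparency false

open scoped Manifold ContDiff Topology
open CategoryTheory Limits Set Literature.AlgebraicTopology.SingularHomology Literature.Geometry.Kaehler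

universe u

namespace Literature.Geometry.Manifold

variable {E : Type u} [NormedAddCommGroup E] [NormedSpace ℝ E]
  {H : Type u} [TopologicalSpace H] (I : ModelWithCorners ℝ E H)
  {M : Type u} [TopologicalSpace M] [ChartedSpace H M]

/-- The real coefficient object `ℝ` (lifted to universe `u`) for cochains, as in the tree's
`subsetCochains.homologyIsoSingularCohomology`. [folklore] -/
abbrev realCoeff : ModuleCat.{u} ℝ := ModuleCat.of ℝ (ULift.{u} ℝ)

/-! ### Integration of a form over a chain -/

section Cochain

variable {I}

/-- **The integration functional of a `k`-form on `k`-chains**: `c ↦ ∑_σ c_σ ∫_σ η`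
(`ℝ`-linear in `c`; meaningful on smooth chains and forms smooth near their images).
de Rham (1931); Warner (1983), 4.17; Lee (2013), p. 481. [cite: LeeSmoothManifolds2013, p. 481] -/
def integrationFunctional {k : ℕ} (η : MForm I M ℝ k) : CChain ℝ M k →ₗ[ℝ] ℝ :=
  Finsupp.lsum ℝ fun σ : SingularSimplex M k ↦ (LinearMap.id : ℝ →ₗ[ℝ] ℝ).smulRight (σ.formIntegral η)

/-- The integration functional on an elementary chain: `∫_{r σ} η = r ∫_σ η`. [folklore] -/
@[simp]
theorem integrationFunctional_single {k : ℕ} (η : MForm I M ℝ k) (σ : SingularSimplex M k) (r : ℝ) :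
    integrationFunctional η (Finsupp.single σ r) = r * σ.formIntegral η := by
  rw [integrationFunctional, Finsupp.lsum_single, LinearMap.smulRight_apply, LinearMap.id_apply, smul_eq_mul]

/-- The integration functional as a sum over the support of the chain. [folklore] -/
theorem integrationFunctional_apply {k : ℕ} (η : MForm I M ℝ k) (c : CChain ℝ M k) :
    integrationFunctional η c = ∑ σ ∈ c.support, c σ * σ.formIntegral η := by
  conv_lhs => rw [← Finsupp.sum_single c]
  rw [Finsupp.sum, map_sum]
  exact Finset.sum_congr rfl fun σ _ ↦ integrationFunctional_single η σ _

/-- **`∫_σ` only depends on the form at the points of the image of `σ`.** [folklore] -/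
theorem _root_.Literature.AlgebraicTopology.SingularHomology.SingularSimplex.formIntegral_congr
    {F : Type*} [NormedAddCommGroup F] [NormedSpace ℝ F] {k : ℕ} (σ : SingularSimplex M k)
    {η₁ η₂ : MForm I M F k} (h : ∀ x ∈ σ.range, η₁ x = η₂ x) : σ.formIntegral η₁ = σ.formIntegral η₂ := by
  refine MeasureTheory.setIntegral_congr_fun measurableSet_Icc fun t ht ↦ ?_
  rw [SingularSimplex.formIntegrand_apply, SingularSimplex.formIntegrand_apply, h _ (σ.cubeMap_mem_range ht)]

/-- The integral of a restricted form over a simplex inside the set is the integral of the form. [folklore] -/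
theorem _root_.Literature.AlgebraicTopology.SingularHomology.SingularSimplex.formIntegral_restr
    {F : Type*} [NormedAddCommGroup F] [NormedSpace ℝ F] {k : ℕ} (σ : SingularSimplex M k)
    (η : MForm I M F k) {U : Set M} (hσ : σ.range ⊆ U) : σ.formIntegral (η.restr U) = σ.formIntegral η :=
  σ.formIntegral_congr fun _ hx ↦ MForm.restr_apply_of_mem η (hσ hx)

/-- The integration functional of a restricted form agrees with that of the form on chains in the
set. [folklore] -/
theorem integrationFunctional_restr {k : ℕ} (η : MForm I M ℝ k) {U : Set M} {c : CChain ℝ M k}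
    (hc : c ∈ chainsIn ℝ ℝ M U k) : integrationFunctional (η.restr U) c = integrationFunctional η c := by
  rw [integrationFunctional_apply, integrationFunctional_apply]
  exact Finset.sum_congr rfl fun σ hσ ↦ by
    rw [SingularSimplex.formIntegral_restr σ η ((mem_chainsIn_iff ℝ ℝ c).1 hc σ hσ)]

variable [IsManifold I ∞ M]

/-- The integration functional is additive in the form, on smooth chains in `U`, for forms on `U`. [folklore] -/
theorem integrationFunctional_add {k : ℕ} {U : Set M} {η₁ η₂ : MForm I M ℝ k}
    (hη₁ : η₁ ∈ smoothFormsOn I ℝ U k) (hη₂ : η₂ ∈ smoothFormsOn I ℝ U k) {c : CChain ℝ M k}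
    (hc : c ∈ smoothChainsInSub I ℝ ℝ M U k) :
    integrationFunctional (η₁ + η₂) c = integrationFunctional η₁ c + integrationFunctional η₂ c := by
  rw [integrationFunctional_apply, integrationFunctional_apply, integrationFunctional_apply,
    ← Finset.sum_add_distrib]
  refine Finset.sum_congr rfl fun σ hσ ↦ ?_
  have hs : σ.IsSmooth I := (mem_smoothChains_iff c).1 hc.1 σ hσ
  have hU : σ.range ⊆ U := (mem_chainsIn_iff ℝ ℝ c).1 hc.2 σ hσ
  rw [SingularSimplex.formIntegral_add hs (fun x hx ↦ hη₁.1 x (hU hx)) (fun x hx ↦ hη₂.1 x (hU hx)), mul_add]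

omit [IsManifold I ∞ M] in
/-- The integration functional is homogeneous in the form. [folklore] -/
theorem integrationFunctional_smul {k : ℕ} (a : ℝ) (η : MForm I M ℝ k) (c : CChain ℝ M k) :
    integrationFunctional (a • η) c = a * integrationFunctional η c := by
  rw [integrationFunctional_apply, integrationFunctional_apply, Finset.mul_sum]
  refine Finset.sum_congr rfl fun σ _ ↦ ?_
  rw [SingularSimplex.formIntegral_smul, smul_eq_mul]
  ring

/-- **Stokes on smooth chains in `U`**: `∫_c d_U η = ∫_{∂c} η` for a form `η` on the open set `U`
and a smooth chain `c` in `U` (`…SingularSimplex.formIntegral_mextDeriv` summed over `c`;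
Lee (2013), Thm. 18.12). [cite: LeeSmoothManifolds2013, Thm. 18.12] -/
theorem integrationFunctional_localD {k : ℕ} {U : Set M} (hU : IsOpen U) (η : smoothFormsOn I ℝ U k)
    {c : CChain ℝ M (k + 1)} (hc : c ∈ smoothChainsInSub I ℝ ℝ M U (k + 1)) :
    integrationFunctional (localD I ℝ k hU η : MForm I M ℝ (k + 1)) c =
      integrationFunctional (η : MForm I M ℝ k) (csingularChainComplex.bd ℝ k c) := by
  rw [coe_localD, integrationFunctional_restr _ hc.2, integrationFunctional_apply]
  conv_rhs => rw [← Finsupp.sum_single c, Finsupp.sum, map_sum, map_sum]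
  refine Finset.sum_congr rfl fun σ hσ ↦ ?_
  have hs : σ.IsSmooth I := (mem_smoothChains_iff c).1 hc.1 σ hσ
  have hUσ : σ.range ⊆ U := (mem_chainsIn_iff ℝ ℝ c).1 hc.2 σ hσ
  rw [SingularSimplex.formIntegral_mextDeriv hs (fun x hx ↦ η.2.1 x (hUσ hx)), csingularChainComplex.bd_single,
    map_sum, Finset.mul_sum]
  refine Finset.sum_congr rfl fun j _ ↦ ?_
  rw [map_smul, integrationFunctional_single, smul_eq_mul, smul_eq_mul]
  ring

end Cochain

/-! ### The de Rham homomorphism in one degree -/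

section Degree

variable {I} [IsManifold I ∞ M]

/-- The integration functional of a form on `U`, restricted to smooth chains in `U` and valued in
`ULift ℝ`: a `k`-cochain of `Hom(Δ^{sm}(U), ℝ)`. [cite: LeeSmoothManifolds2013, p. 481] -/
def deRhamCochain {U : Set M} {k : ℕ} (η : smoothFormsOn I ℝ U k) :
    (smoothChainsInSub I ℝ ℝ M U).toComplex.X k ⟶ realCoeff :=
  ModuleCat.ofHom (ULift.moduleEquiv.symm.toLinearMap ∘ₗ
    (integrationFunctional (η : MForm I M ℝ k)).domRestrict (smoothChainsInSub I ℝ ℝ M U k))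

omit [IsManifold I ∞ M] in
/-- Values of the de Rham cochain: `(Ψ η)(c) = ∫_c η`. [folklore] -/
@[simp]
theorem deRhamCochain_apply {U : Set M} {k : ℕ} (η : smoothFormsOn I ℝ U k)
    (c : (smoothChainsInSub I ℝ ℝ M U).toComplex.X k) :
    (deRhamCochain η c).down = integrationFunctional (η : MForm I M ℝ k) c.1 :=
  rfl

/-- The real value `ψ(c)` of a cochain of `Hom(Δ^{sm}(U), ℝ)` on a smooth chain (unwrapping the
`ModuleCat`/`ULift` packaging). [folklore] -/
abbrev cochainVal {U : Set M} {k : ℕ} (ψ : (smoothSubsetCochains I ℝ realCoeff M U).X k)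
    (c : (smoothChainsInSub I ℝ ℝ M U).toComplex.X k) : ℝ :=
  ((ModuleCat.Hom.hom (ψ : (smoothChainsInSub I ℝ ℝ M U).toComplex.X k ⟶ realCoeff)) c).down

variable (I) in
/-- **The de Rham homomorphism in degree `k` on the open set `U`**: `η ↦ (c ↦ ∫_c η)`, a linear
map `Ωᵏ(U) → Hom_ℝ(Δₖ^{sm}(U), ℝ)` (Bredon (1993), §V.5, `Ψ`; Lee (2013), p. 482, `ℐ`).
[cite: Bredon1993, §V.5] -/
def deRhamMapDeg {U : Set M} (k : ℕ) :
    smoothFormsOn I ℝ U k →ₗ[ℝ] ((smoothSubsetCochains I ℝ realCoeff M U).X k) where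
  toFun η := deRhamCochain η
  map_add' η₁ η₂ := by
    refine ModuleCat.hom_ext (LinearMap.ext fun c ↦ ULift.ext _ _ ?_)
    change integrationFunctional ((η₁ : MForm I M ℝ k) + (η₂ : MForm I M ℝ k)) c.1 =
      integrationFunctional (η₁ : MForm I M ℝ k) c.1 + integrationFunctional (η₂ : MForm I M ℝ k) c.1
    exact integrationFunctional_add η₁.2 η₂.2 c.2
  map_smul' a η := by
    refine ModuleCat.hom_ext (LinearMap.ext fun c ↦ ULift.ext _ _ ?_)
    change integrationFunctional (a • (η : MForm I M ℝ k)) c.1 = a * integrationFunctional (η : MForm I M ℝ k) c.1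
    exact integrationFunctional_smul a _ _

/-- Values of the de Rham homomorphism in degree `k`. [folklore] -/
theorem deRhamMapDeg_cochainVal {U : Set M} {k : ℕ} (η : smoothFormsOn I ℝ U k)
    (c : (smoothChainsInSub I ℝ ℝ M U).toComplex.X k) :
    cochainVal (deRhamMapDeg I k η) c = integrationFunctional (η : MForm I M ℝ k) c.1 :=
  rfl

end Degree

/-! ### The de Rham homomorphism as a morphism of cochain complexes -/

section Complex

variable [IsManifold I ∞ M]

/-- **The de Rham homomorphism `Ψ_U : Ω•(U) ⟶ Hom(Δ•^{smooth}(U), ℝ)`** for an open `U ⊆ M`: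
integration of forms on `U` over smooth singular simplices in `U`. It is a morphism of cochain
complexes by Stokes' formula, `∫_c dη = ∫_{∂c} η` (de Rham 1931; Bredon (1993), §V.5 and
Thm. V.9.5; Lee (2013), Thm. 18.14, the map `ℐ`; Warner (1983), 4.17–4.19). [cite: Bredon1993, Thm. V.9.5] -/
def deRhamMap {U : Set M} (hU : IsOpen U) :
    localDeRhamComplex I ℝ hU ⟶ smoothSubsetCochains I ℝ realCoeff M U where
  f k := ModuleCat.ofHom (deRhamMapDeg I k)
  comm' i j hij := by
    change i + 1 = j at hij
    subst hij
    rw [localDeRhamComplex_d]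
    refine ModuleCat.hom_ext (LinearMap.ext fun η ↦ ?_)
    change (smoothSubsetCochains I ℝ realCoeff M U).d i (i + 1) (deRhamMapDeg I i η) =
      deRhamMapDeg I (i + 1) (localD I ℝ i hU η)
    rw [dualObj_d_apply]
    refine ModuleCat.hom_ext (LinearMap.ext fun c ↦ ULift.ext _ _ ?_)
    change integrationFunctional (η.1 : MForm I M ℝ i) ((smoothChainsInSub I ℝ ℝ M U).toComplex.d (i + 1) i c).1 =
      integrationFunctional ((localD I ℝ i hU η).1 : MForm I M ℝ (i + 1)) c.1
    rw [toComplex_d_val, integrationFunctional_localD hU η c.2]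

variable {I}

/-- Values of the de Rham homomorphism: `(Ψ_U η)(c) = ∫_c η`. [folklore] -/
theorem deRhamMap_cochainVal {U : Set M} (hU : IsOpen U) (k : ℕ) (η : (localDeRhamComplex I ℝ hU).X k)
    (c : (smoothChainsInSub I ℝ ℝ M U).toComplex.X k) :
    cochainVal ((deRhamMap I hU).f k η) c = integrationFunctional (η.1 : MForm I M ℝ k) c.1 :=
  rfl

/-- **Naturality of the de Rham homomorphism under restriction**: for open `U ⊆ V`,
`res ≫ Ψ_U = Ψ_V ≫ res` (`∫` over a simplex in `U` of `η|_U` is `∫` of `η`). Bredon (1993),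
§V.9 (functoriality of `Ψ` in `U`). [cite: Bredon1993, §V.9] -/
@[reassoc]
theorem deRhamMap_naturality_res {U V : Set M} (hU : IsOpen U) (hV : IsOpen V) (hUV : U ⊆ V) :
    localDeRhamComplex.res I ℝ hU hV hUV ≫ deRhamMap I hU =
      deRhamMap I hV ≫ smoothSubsetCochains.res I ℝ realCoeff hUV := by
  ext k η
  change (deRhamMap I hU).f k (restrictₗ I ℝ k hU hUV η) =
    (smoothSubsetCochains.res I ℝ realCoeff hUV).f k ((deRhamMap I hV).f k η)
  rw [dualMap_f_apply]
  refine ModuleCat.hom_ext (LinearMap.ext fun c ↦ ULift.ext _ _ ?_)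
  change integrationFunctional ((η.1 : MForm I M ℝ k).restr U) c.1 =
    integrationFunctional (η.1 : MForm I M ℝ k)
      ((Subcomplex.incl (smoothChainsInSub_mono (I := I) (R := ℝ) (A := ℝ) hUV)).f k c).1
  rw [Subcomplex.incl_f_apply_val, integrationFunctional_restr _ c.2.2]

/-! ### The Mayer–Vietoris ladder -/

variable (I)

/-- **The de Rham homomorphisms form a morphism of Mayer–Vietoris short complexes**
`(Ω•(A ∪ B), Ω•(A) ⊞ Ω•(B), Ω•(A ∩ B)) ⟶ (Hom(Δ^{sm}(A) + Δ^{sm}(B)), Hom(Δ^{sm}A) ⊞ Hom(Δ^{sm}B), Hom(Δ^{sm}(A ∩ B)))`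
(Bredon (1993), proof of Thm. V.9.5, the commutative ladder). [cite: Bredon1993, Thm. V.9.5] -/
def deRhamMap_mv {A B : Set M} (hA : IsOpen A) (hB : IsOpen B) :
    localDeRhamComplex.mvShortComplex I ℝ hA hB ⟶ smoothSubsetCochains.mvShortComplex I ℝ realCoeff A B where
  τ₁ := deRhamMap I (hA.union hB) ≫ smoothSubsetCochains.resSup I ℝ realCoeff A B
  τ₂ := biprod.map (deRhamMap I hA) (deRhamMap I hB)
  τ₃ := deRhamMap I (hA.inter hB)
  comm₁₂ := by
    dsimp only [localDeRhamComplex.mvShortComplex, smoothSubsetCochains.mvShortComplex]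
    apply biprod.hom_ext
    · simp only [Category.assoc, biprod.lift_fst, biprod.map_fst, biprod.lift_fst_assoc]
      rw [← dualMap_comp, Subcomplex.incl_comp_incl]
      exact (deRhamMap_naturality_res hA (hA.union hB) subset_union_left).symm
    · simp only [Category.assoc, biprod.lift_snd, biprod.map_snd, biprod.lift_snd_assoc]
      rw [← dualMap_comp, Subcomplex.incl_comp_incl]
      exact (deRhamMap_naturality_res hB (hA.union hB) subset_union_right).symm
  comm₂₃ := by
    dsimp only [localDeRhamComplex.mvShortComplex, smoothSubsetCochains.mvShortComplex]
    apply biprod.hom_ext'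
    · rw [biprod.inl_map_assoc, biprod.inl_desc, biprod.inl_desc_assoc, deRhamMap_naturality_res]
    · rw [biprod.inr_map_assoc, biprod.inr_desc, biprod.inr_desc_assoc, Preadditive.comp_neg,
        Preadditive.neg_comp, deRhamMap_naturality_res]

variable {I}

/-- **Mayer–Vietoris step for the de Rham homomorphism** (Bredon (1993), Lemma V.9.4 in the proof
of Thm. V.9.5): if `Ψ_A`, `Ψ_B` and `Ψ_{A∩B}` induce isomorphisms on cohomology in all degrees, so
does `Ψ_{A∪B}`, for `A`, `B` open (on a Hausdorff second-countable manifold with finite-dimensional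
model, where the Mayer–Vietoris sequence of forms is exact). [cite: Bredon1993, Lemma V.9.4] -/
theorem isIso_homologyMap_deRhamMap_union [FiniteDimensional ℝ E] [T2Space M] [SecondCountableTopology M]
    {A B : Set M} (hA : IsOpen A) (hB : IsOpen B)
    (ha : ∀ p, IsIso (HomologicalComplex.homologyMap (deRhamMap I hA) p))
    (hb : ∀ p, IsIso (HomologicalComplex.homologyMap (deRhamMap I hB) p))
    (hab : ∀ p, IsIso (HomologicalComplex.homologyMap (deRhamMap I (hA.inter hB)) p)) (p : ℕ) :
    IsIso (HomologicalComplex.homologyMap (deRhamMap I (hA.union hB)) p) := by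
  have h1 : IsIso (HomologicalComplex.homologyMap
      (deRhamMap I (hA.union hB) ≫ smoothSubsetCochains.resSup I ℝ realCoeff A B) p) := by
    have h := Literature.Algebra.Homology.isIso_homologyMap_τ₁_of_forall (deRhamMap_mv I hA hB)
      localDeRhamComplex.mvShortComplex_shortExact
      (smoothSubsetCochains.mvShortComplex_shortExact I ℝ realCoeff A B) (fun j ↦ ?_) (fun j ↦ hab j) p
    · exact h
    · haveI := ha j
      haveI := hb j
      exact smoothSubsetCochains.isIso_homologyMap_biprod_map ℝ _ _ j
  rw [HomologicalComplex.homologyMap_comp] at h1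
  haveI := smoothSubsetCochains.isIso_homologyMap_resSup (I := I) (N := realCoeff) hA hB p
  exact IsIso.of_isIso_comp_right _ (HomologicalComplex.homologyMap (smoothSubsetCochains.resSup I ℝ realCoeff A B) p)

end Complex

/-! ### Naturality under smooth maps (whole manifolds) -/

section Map

variable {I} [IsManifold I ∞ M]
  {E' : Type u} [NormedAddCommGroup E'] [NormedSpace ℝ E']
  {H' : Type u} [TopologicalSpace H'] {I' : ModelWithCorners ℝ E' H'}
  {N : Type u} [TopologicalSpace N] [ChartedSpace H' N] [IsManifold I' ∞ N]

omit [IsManifold I ∞ M] [IsManifold I' ∞ N] in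
/-- A form on all of `N` (in the sense of `smoothFormsOn univ`) is a smooth form. [folklore] -/
theorem isSmoothForm_of_mem_smoothFormsOn_univ {k : ℕ} {η : MForm I' N ℝ k}
    (hη : η ∈ smoothFormsOn I' ℝ (univ : Set N) k) : IsSmoothForm η := by
  rwa [smoothFormsOn_univ, mem_smoothForms_iff] at hη

/-- Pull-back of a form on all of `N` along a `C^∞` map is a form on all of `M`. [cite: WarnerGTM94, 2.22] -/
theorem pullback_mem_smoothFormsOn_univ {φ : M → N} (hφ : ContMDiff I I' ∞ φ) {k : ℕ}
    {η : MForm I' N ℝ k} (hη : η ∈ smoothFormsOn I' ℝ (univ : Set N) k) :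
    η.pullback I φ ∈ smoothFormsOn I ℝ (univ : Set M) k := by
  rw [smoothFormsOn_univ, mem_smoothForms_iff]
  exact Literature.NumberTheory.Transcendental.isSmoothForm_pullback hφ
    (isSmoothForm_of_mem_smoothFormsOn_univ hη)

variable (I) in
/-- **Pull-back of forms along a `C^∞` map `φ : M → N`, as a morphism of de Rham complexes of the
whole manifolds** `Ω•(N) ⟶ Ω•(M)` (`d` commutes with pull-back, Warner (1983), Prop. 2.23).
[cite: WarnerGTM94, Prop. 2.23] -/
def localDeRhamComplex.pullbackUniv {φ : M → N} (hφ : ContMDiff I I' ∞ φ) :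
    localDeRhamComplex I' ℝ (isOpen_univ : IsOpen (univ : Set N)) ⟶
      localDeRhamComplex I ℝ (isOpen_univ : IsOpen (univ : Set M)) where
  f k := ModuleCat.ofHom
    { toFun := fun η ↦ ⟨(η.1 : MForm I' N ℝ k).pullback I φ, pullback_mem_smoothFormsOn_univ hφ η.2⟩
      map_add' := fun _ _ ↦ rfl
      map_smul' := fun _ _ ↦ rfl }
  comm' i j hij := by
    change i + 1 = j at hij
    subst hij
    rw [localDeRhamComplex_d, localDeRhamComplex_d]
    refine ModuleCat.hom_ext (LinearMap.ext fun η ↦ Subtype.ext ?_)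
    have hη : IsSmoothForm (η.1 : MForm I' N ℝ i) := isSmoothForm_of_mem_smoothFormsOn_univ η.2
    change (mextDeriv ((η.1 : MForm I' N ℝ i).pullback I φ)).restr univ =
      ((mextDeriv (η.1 : MForm I' N ℝ i)).restr univ).pullback I φ
    rw [MForm.restr_univ, MForm.restr_univ]
    exact Literature.NumberTheory.Transcendental.mextDeriv_pullback hφ hη

/-- The pull-back morphism on an element. [folklore] -/
@[simp]
theorem localDeRhamComplex.pullbackUniv_f_apply_coe {φ : M → N} (hφ : ContMDiff I I' ∞ φ) (k : ℕ)
    (η : (localDeRhamComplex I' ℝ (isOpen_univ : IsOpen (univ : Set N))).X k) :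
    ((localDeRhamComplex.pullbackUniv I hφ).f k η).1 = (η.1 : MForm I' N ℝ k).pullback I φ :=
  rfl

/-- **Push-forward of smooth chains of `M` to smooth chains of `N`** along a `C^∞` map (the chain
map `φ♯` restricted to the smooth subcomplexes). [cite: LeeSmoothManifolds2013, Ch. 18 p. 474] -/
abbrev smoothPush {φ : M → N} (hφ : ContMDiff I I' ∞ φ) :
    (smoothChainsInSub I ℝ ℝ M univ).toComplex ⟶ (smoothChainsInSub I' ℝ ℝ N univ).toComplex :=
  Subcomplex.subMap (csingularChainComplex.map ℝ ℝ ⟨φ, hφ.continuous⟩) _ _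
    (smoothChainsInSub_le_comap_map hφ (mapsTo_univ φ univ))

omit [IsManifold I ∞ M] [IsManifold I' ∞ N] in
/-- The integration functional of `η` on a pushed-forward smooth chain is that of `φ^*η` on the
chain: `∫_{φ♯c} η = ∫_c φ^*η`. [cite: LeeSmoothManifolds2013, Prop. 18.9] -/
theorem integrationFunctional_mapDomain {φ : M → N} (hφ : ContMDiff I I' ∞ φ) {k : ℕ}
    (η : MForm I' N ℝ k) {c : CChain ℝ M k} (hc : c ∈ smoothChains I ℝ ℝ M k) :
    integrationFunctional η (Finsupp.mapDomain (fun σ : SingularSimplex M k ↦ σ.map ⟨φ, hφ.continuous⟩) c) =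
      integrationFunctional (η.pullback I φ) c := by
  rw [Finsupp.mapDomain, Finsupp.sum, map_sum, integrationFunctional_apply]
  refine Finset.sum_congr rfl fun σ hσ ↦ ?_
  rw [integrationFunctional_single,
    SingularSimplex.formIntegral_map ((mem_smoothChains_iff c).1 hc σ hσ) hφ η]

/-- **Naturality of the de Rham homomorphism under `C^∞` maps** (whole manifolds):
`φ^* ≫ Ψ_M = Ψ_N ≫ (φ♯)^*`, i.e. `∫_c φ^*η = ∫_{φ♯ c} η` (Lee (2013), Prop. 18.9(c) and the
proof of Thm. 18.14; Bredon (1993), §V.9, naturality of `Ψ`). [cite: LeeSmoothManifolds2013, Thm. 18.14] -/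
theorem pullbackUniv_comp_deRhamMap {φ : M → N} (hφ : ContMDiff I I' ∞ φ) :
    localDeRhamComplex.pullbackUniv I hφ ≫ deRhamMap I (isOpen_univ : IsOpen (univ : Set M)) =
      deRhamMap I' (isOpen_univ : IsOpen (univ : Set N)) ≫ dualMap ℝ realCoeff (smoothPush hφ) := by
  ext k η
  change (deRhamMap I _).f k ((localDeRhamComplex.pullbackUniv I hφ).f k η) =
    (dualMap ℝ realCoeff (smoothPush hφ)).f k ((deRhamMap I' _).f k η)
  rw [dualMap_f_apply]
  refine ModuleCat.hom_ext (LinearMap.ext fun c ↦ ULift.ext _ _ ?_)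
  change integrationFunctional ((η.1 : MForm I' N ℝ k).pullback I φ) c.1 =
    integrationFunctional (η.1 : MForm I' N ℝ k) ((smoothPush hφ).f k c).1
  rw [Subcomplex.subMap_f_apply_val, csingularChainComplex.map_f_apply,
    integrationFunctional_mapDomain hφ _ c.2.1]

end Map

end Literature.Geometry.Manifold
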